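import Summits.Ventures.GridStability.Models.StructurePreservingSlab

/-!
# GridStability/Models/StructurePreservingSlabWindow — the SLAB certificate for MV-3 with every
# hypothesis reduced to RATIONAL tests on the producer's declared data (half-angle-tangent windows)

LADDER-GRIDFUSION G2 «SP–Lur'e lane» / G3 register, seat gridfusion-model-2 (g6); companion of
`StructurePreservingSlab.lean`. For instances typed with half-angle tangents (`NE39SP`, `WSCC9SP`:
window `|σ*_e| ≤ θ = 2·arctan τ`, `0 ≤ τ < 1`) and a producer who DECLARES the slab half-width as
`γ = 2·arctan u` (`u ∈ ℚ`, `0 < u ≤ 1`):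
* `cos_two_arctan_add` — `cos(2·arctan τ + 2·arctan u) = ((1 − τ²)(1 − u²) − 4τu)/((1 + τ²)(1 + u²))`,
  an EXACT RATIONAL lower sector slope `a₀` for every channel (`relLurie_slab_sector_of_window`);
* `two_arctan_add_lt_pi` — `θ + γ < π` from `τ < 1`, `u ≤ 1`;
* `lt_two_arctan_of_sq_le` — a rational `γ_lo ≥ 0` with `γ_lo²(1 + u²) ≤ 4u²` is STRICTLY below `γ`
  (`arctan u > sin(arctan u) = u/√(1 + u²)`), so `2c ≤ ε·γ_lo²` is an admissible ε-level and
  `|σ_e(0) − σ*_e| ≤ γ_lo` an admissible initial test;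
* `tendsto_relState_of_slabCertificate_of_window` — lit-6's slab theorem for MV-3 phase solutions with
  ALL side conditions in that rational form: the producer supplies `Λ : SlabCertificate` (two PSD facts),
  `u`, `γ_lo`, and the comparisons `Λ.a e ≤ a₀`, `1 ≤ Λ.b e`, `2c ≤ ε·γ_lo²`.
THREE COLUMNS: MODELLED column only (typing); no certificate here; nothing says a grid is stable.
MODELLED: absent effects = MODEL-VALIDITY MV-3; reference bus = bookkeeping.
-/

noncomputable section

open Finset Real Set Filter Matrix
open scoped Topology
open Literature.MathematicalPhysics.PowerSystems
open Literature.MathematicalPhysics.PowerSystems.LyapunovFunctionFamily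

namespace Summit.Ventures.GridStability.Models.StructurePreserving

/-! ## Half-angle-tangent arithmetic for the slab -/

/-- `cos(2·arctan τ + 2·arctan u) = ((1 − τ²)(1 − u²) − 4τu)/((1 + τ²)(1 + u²))` — the exact
rational value of `cos(θ + γ)` for half-angle-tangent data. [folklore] -/
theorem cos_two_arctan_add (τ u : ℝ) :
    Real.cos (2 * Real.arctan τ + 2 * Real.arctan u)
      = ((1 - τ ^ 2) * (1 - u ^ 2) - 4 * τ * u) / ((1 + τ ^ 2) * (1 + u ^ 2)) := by
  rw [Real.cos_add, Lyapunov.StructurePreserving.cos_two_mul_arctan,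
    Lyapunov.StructurePreserving.cos_two_mul_arctan, Lyapunov.StructurePreserving.sin_two_mul_arctan,
    Lyapunov.StructurePreserving.sin_two_mul_arctan]
  have h1 : (1 + τ ^ 2) ≠ 0 := by positivity
  have h2 : (1 + u ^ 2) ≠ 0 := by positivity
  field_simp
  ring

/-- `2·arctan τ + 2·arctan u < π` for `τ < 1`, `u ≤ 1` (`θ < π/2`, `γ ≤ π/2`). [folklore] -/
theorem two_arctan_add_lt_pi {τ u : ℝ} (hτ : τ < 1) (hu : u ≤ 1) :
    2 * Real.arctan τ + 2 * Real.arctan u < π := by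
  have h1 := Lyapunov.StructurePreserving.two_mul_arctan_lt_pi_div_two hτ
  have h2 : 2 * Real.arctan u ≤ π / 2 := by
    have := Real.arctan_strictMono.monotone hu
    rw [Real.arctan_one] at this
    linarith
  linarith

/-- **A rational number strictly below the slab half-width**: for `u > 0` and `γ_lo ≥ 0` with
`γ_lo²(1 + u²) ≤ 4u²`, `γ_lo < 2·arctan u` (`γ_lo ≤ 2u/√(1 + u²) = 2·sin(arctan u) < 2·arctan u`).
[folklore] -/
theorem lt_two_arctan_of_sq_le {u γlo : ℝ} (hu : 0 < u) (hγ0 : 0 ≤ γlo)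
    (hγ : γlo ^ 2 * (1 + u ^ 2) ≤ 4 * u ^ 2) : γlo < 2 * Real.arctan u := by
  have hat : 0 < Real.arctan u := by
    have := Real.arctan_strictMono hu
    rwa [Real.arctan_zero] at this
  have hsin : Real.sin (Real.arctan u) < Real.arctan u := Real.sin_lt hat
  rw [Real.sin_arctan] at hsin
  have hpos : 0 < Real.sqrt (1 + u ^ 2) := Real.sqrt_pos.2 (by positivity)
  have hsq : Real.sqrt (1 + u ^ 2) ^ 2 = 1 + u ^ 2 := Real.sq_sqrt (by positivity)
  have hle : γlo * Real.sqrt (1 + u ^ 2) ≤ 2 * u := by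
    have hprod : (γlo * Real.sqrt (1 + u ^ 2)) ^ 2 ≤ (2 * u) ^ 2 := by
      rw [mul_pow, hsq]; linarith
    exact (pow_le_pow_iff_left₀ (mul_nonneg hγ0 hpos.le) (by linarith) two_ne_zero).1 hprod
  have hle' : γlo ≤ 2 * (u / Real.sqrt (1 + u ^ 2)) := by
    rw [mul_div_assoc', le_div_iff₀ hpos]
    exact hle
  linarith

namespace Params

variable {k g m : ℕ} {p : Params (k + 1)} {r : Fin (k + 1)} {gnode : Fin g → Fin (k + 1)}
  {src tgt : Fin m → Fin (k + 1)} {wt : Fin m → ℝ} {δs : Fin (k + 1) → ℝ}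

/-! ## The slab certificate for MV-3 with rational side conditions -/

/-- **SLAB CERTIFICATE FOR MV-3, ALL SIDE CONDITIONS RATIONAL.** Data: well formed, reference load bus
`r ∉ gen`, injective enumeration of `gen`, edge-list couplings, `P⁰ = f(δ*)`, a window
`|σ*_e| ≤ 2·arctan τ` (`0 ≤ τ < 1`) on the listed lines; a producer's `Λ : SlabCertificate` on the
relative object, a declared slab parameter `u` (`0 < u ≤ 1`, half-width `γ = 2·arctan u`) and a rational
`γ_lo ≥ 0` with `γ_lo²(1 + u²) ≤ 4u²`; sector slopes `Λ.a e ≤ a₀ := ((1 − τ²)(1 − u²) − 4τu)/((1 + τ²)(1 + u²))`,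
`1 ≤ Λ.b e`; a level with `2c ≤ ε·γ_lo²`. Conclusion: every phase solution of `p.phaseField` whose
initial listed line-angle deviations satisfy `|σ_e(0) − σ*_e| ≤ γ_lo` and with `V(relState(X 0)) ≤ c`
keeps `|σ_e(t) − σ*_e| < γ` and `V ≤ c` for all `t ≥ 0`, and its relative state tends to `0`.
CERTIFIED given `Λ`; MODEL MV-3; inner estimate. [cite: Pai1981, §2.16 Theorem [18] and §4.6–§4.7; VuTuritsyn2017, §4.3 Theorem 1] -/
theorem tendsto_relState_of_slabCertificate_of_window (hp : p.WellFormed) (hr : r ∉ p.gen)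
    (hginj : Function.Injective gnode) (hgen : ∀ v, v ∈ p.gen ↔ ∃ j, gnode j = v)
    (hb : p.b = symmetrize (edgeWeight src tgt wt)) (hP : ∀ v, p.pe δs v = p.P0 v)
    (Λ : SlabCertificate (p.relLurie r gnode src tgt wt δs))
    {τ : ℝ} (hτ1 : τ < 1) (hwin : ∀ e, |δs (src e) - δs (tgt e)| ≤ 2 * Real.arctan τ)
    {u γlo : ℝ} (hu0 : 0 < u) (hu1 : u ≤ 1) (hγ0 : 0 ≤ γlo)
    (hγ : γlo ^ 2 * (1 + u ^ 2) ≤ 4 * u ^ 2)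
    (ha : ∀ e, Λ.a e ≤ ((1 - τ ^ 2) * (1 - u ^ 2) - 4 * τ * u) / ((1 + τ ^ 2) * (1 + u ^ 2)))
    (hb1 : ∀ e, 1 ≤ Λ.b e)
    {c : ℝ} (hc : 2 * c ≤ Λ.ε * γlo ^ 2)
    {X : ℝ → (Fin (k + 1) → ℝ) × (Fin (k + 1) → ℝ)}
    (hX : ∀ T : ℝ, ∀ t ∈ Icc 0 T, HasDerivWithinAt X (p.phaseField (X t)) (Icc 0 T) t)
    (h0 : ∀ e, |((X 0).1 (src e) - (X 0).1 (tgt e)) - (δs (src e) - δs (tgt e))| ≤ γlo)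
    (hVc : Λ.V (relState r gnode δs (X 0)) ≤ c) :
    (∀ t, 0 ≤ t →
        (∀ e, |((X t).1 (src e) - (X t).1 (tgt e)) - (δs (src e) - δs (tgt e))|
          < 2 * Real.arctan u) ∧
        Λ.V (relState r gnode δs (X t)) ≤ c) ∧
      Tendsto (fun t => relState r gnode δs (X t)) atTop (𝓝 0) := by
  have hγpos : 0 ≤ 2 * Real.arctan u := Lyapunov.StructurePreserving.two_mul_arctan_nonneg hu0.le
  have hθγ : 2 * Real.arctan τ + 2 * Real.arctan u ≤ π := (two_arctan_add_lt_pi hτ1 hu1).le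
  have ha' : ∀ e, Λ.a e ≤ Real.cos (2 * Real.arctan τ + 2 * Real.arctan u) := fun e => by
    rw [cos_two_arctan_add]; exact ha e
  have hsec := relLurie_slab_sector_of_window (p := p) (r := r) (gnode := gnode) (src := src)
    (tgt := tgt) (wt := wt) (δs := δs) Λ hγpos hθγ hwin ha' hb1
  have hlt : γlo < 2 * Real.arctan u := lt_two_arctan_of_sq_le hu0 hγ0 hγ
  have hc' : ∀ e : Fin m, 2 * c < Λ.ε * (2 * Real.arctan u) ^ 2 := fun _ => by
    have hsq : γlo ^ 2 < (2 * Real.arctan u) ^ 2 := pow_lt_pow_left₀ hlt hγ0 two_ne_zero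
    have := mul_lt_mul_of_pos_left hsq Λ.ε_pos
    linarith
  have hfr := relLurie_lt_V_frontier_slab_of_eps Λ (γ := fun _ => 2 * Real.arctan u) hsec hc'
  have h0' : ∀ e, |((X 0).1 (src e) - (X 0).1 (tgt e)) - (δs (src e) - δs (tgt e))|
      < 2 * Real.arctan u := fun e => (h0 e).trans_lt hlt
  exact tendsto_relState_of_slabCertificate hp hr hginj hgen hb hP Λ hsec hfr hX h0' hVc

/-- **The same for the structure-preserving model AS PRINTED** (`p.IsSolution δ`, any `P⁰`,
synchronous equilibrium `δ*` with frequency `ω₀`; `|σ_e(0) − σ*_e| ≤ γ_lo`, `V ≤ c` for the initial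
relative state `relState(δ(0), δ̇(0) − ω₀)`): deviations stay `< 2·arctan u`, every angle difference
tends to the equilibrium's, every generator speed tends to `ω₀`. MODEL MV-3; nothing here says a grid is
stable. [cite: Pai1981, §2.16 Theorem [18] and §4.7; VuTuritsyn2017, §4.3 Theorem 1; Padiyar2013, §3.2 eq (3.2)] -/
theorem tendsto_of_isSolution_of_slabCertificate_of_window (hp : p.WellFormed) (hr : r ∉ p.gen)
    (hginj : Function.Injective gnode) (hgen : ∀ v, v ∈ p.gen ↔ ∃ j, gnode j = v)
    (hb : p.b = symmetrize (edgeWeight src tgt wt)) (hδeq : p.IsSyncEquilibrium δs)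
    (Λ : SlabCertificate (p.relLurie r gnode src tgt wt δs))
    {τ : ℝ} (hτ1 : τ < 1) (hwin : ∀ e, |δs (src e) - δs (tgt e)| ≤ 2 * Real.arctan τ)
    {u γlo : ℝ} (hu0 : 0 < u) (hu1 : u ≤ 1) (hγ0 : 0 ≤ γlo)
    (hγ : γlo ^ 2 * (1 + u ^ 2) ≤ 4 * u ^ 2)
    (ha : ∀ e, Λ.a e ≤ ((1 - τ ^ 2) * (1 - u ^ 2) - 4 * τ * u) / ((1 + τ ^ 2) * (1 + u ^ 2)))
    (hb1 : ∀ e, 1 ≤ Λ.b e)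
    {c : ℝ} (hc : 2 * c ≤ Λ.ε * γlo ^ 2)
    {δ : ℝ → Fin (k + 1) → ℝ} (hδ : p.IsSolution δ)
    (h0 : ∀ e, |(δ 0 (src e) - δ 0 (tgt e)) - (δs (src e) - δs (tgt e))| ≤ γlo)
    (hVc : Λ.V (relState r gnode δs (δ 0, fun v => deriv (fun u => δ u v) 0 - p.syncFreq)) ≤ c) :
    (∀ t, 0 ≤ t → ∀ e, |(δ t (src e) - δ t (tgt e)) - (δs (src e) - δs (tgt e))|
        < 2 * Real.arctan u) ∧
      (∀ v w, Tendsto (fun t => δ t v - δ t w) atTop (𝓝 (δs v - δs w))) ∧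
      ∀ v ∈ p.gen, Tendsto (fun t => deriv (fun u => δ u v) t) atTop (𝓝 p.syncFreq) := by
  have hγpos : 0 ≤ 2 * Real.arctan u := Lyapunov.StructurePreserving.two_mul_arctan_nonneg hu0.le
  have hθγ : 2 * Real.arctan τ + 2 * Real.arctan u ≤ π := (two_arctan_add_lt_pi hτ1 hu1).le
  have ha' : ∀ e, Λ.a e ≤ Real.cos (2 * Real.arctan τ + 2 * Real.arctan u) := fun e => by
    rw [cos_two_arctan_add]; exact ha e
  have hsec := relLurie_slab_sector_of_window (p := p) (r := r) (gnode := gnode) (src := src)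
    (tgt := tgt) (wt := wt) (δs := δs) Λ hγpos hθγ hwin ha' hb1
  have hlt : γlo < 2 * Real.arctan u := lt_two_arctan_of_sq_le hu0 hγ0 hγ
  have hc' : ∀ e : Fin m, 2 * c < Λ.ε * (2 * Real.arctan u) ^ 2 := fun _ => by
    have hsq : γlo ^ 2 < (2 * Real.arctan u) ^ 2 := pow_lt_pow_left₀ hlt hγ0 two_ne_zero
    have := mul_lt_mul_of_pos_left hsq Λ.ε_pos
    linarith
  have hfr := relLurie_lt_V_frontier_slab_of_eps Λ (γ := fun _ => 2 * Real.arctan u) hsec hc'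
  have h0' : ∀ e, |(δ 0 (src e) - δ 0 (tgt e)) - (δs (src e) - δs (tgt e))|
      < 2 * Real.arctan u := fun e => (h0 e).trans_lt hlt
  exact tendsto_of_isSolution_of_slabCertificate hp hr hginj hgen hb hδeq Λ hsec hfr hδ h0' hVc

end Params

end Summit.Ventures.GridStability.Models.StructurePreserving

end
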